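import Summits.QuantumAdvantage.QuantumAdvantage.Theorems.CubicForrelationNearExactIsExactTwelveTypeO992LevelSixAt2932
import Summits.QuantumAdvantage.QuantumAdvantage.Theorems.CubicForrelationNearExactIsExactTwelveLevelFiveHyperplaneGe2932

/-!
# Crux `CubicForrelation.NearExactIsExact` (stmt-QuantumAdvantage-14043) — n = 12, type O with base set `992` AT `Φ = 29/32`: a level-5 PARTNER
  is impossible too — hence NO type-O side with base `992` at `Φ ≥ 29/32` at all

Certificate seat `b2b-cforr-cert` (gen 22).  HONEST FRAMING: a kernel-checked lemma (standard axioms, no `decide`) about cubic Boolean pairs on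
12 bits — the last sub-case of the base-`992` configuration of the boundary rung `29/32` (HOME/b2b-cforr-cert-g22/PLAN-N12-928-EQ.md); with
`to22_typeO_E992_typeO_partner_false` (…TwelveTypeO992At2932) and `to22_typeO_E992_levelSix_partner_false` (…TwelveTypeO992LevelSixAt2932) the
base `992` is DEAD at `Φ ≥ 29/32` (`to22_typeO_E992_ge2932_false`).  NO new value of `θ₁₂` by itself.  NOT summit progress.

`to22_typeO_E992_levelFive_partner_false`: cubic `f, g`, `W_g = 16u` (some `u` odd) with `#E = 992`, `W_f = 32u'_f` with some `u'_f` odd,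
`Φ(f,g) ≥ 29/32` is impossible.  Proof: by the dichotomy the wild function has `v̂ = 8k`, `k ∈ {0, ±2}` on a set `K` of `256` characters; by
`to22_char_sum_E992_structure` `Ê = 32m`, `m` odd exactly on a hyperplane `M ∋ 0`; the partner identity with `u_f = 2u'_f` gives
`u'_f(y) = 2(−1)^g − 32s_b[y = c₁] + s_b m(c₁⊕y) − k(y)/2`, so the odd set `P_f` of `u'_f` is `M' Δ K` (`M' = c₁ ⊕ M`); `#P_f = 2048`
(`tw22_oddset_card_ge2932`) forces `#(M' ∩ K) = 128`, so `#(P_f ∩ M') = 1920`; but `P_f` is an affine hyperplane (`tw22_hyperplane_ge2932`) and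
`P_f ∩ M'` a translate of the subspace `V_f ∩ M`, whose size divides `4096` (`card_mul_card_perp`) — `1920 ∤ 4096`.

References: Kasami–Tokura (1970); MacWilliams–Sloane (1977) Ch. 13–15; O'Donnell (2014) §3.3.  Axioms: the standard three.
-/

set_option linter.dupNamespace false -- D-0017: single-problem summit ⇒ `QuantumAdvantage.QuantumAdvantage` by design

noncomputable section

namespace Summit.QuantumAdvantage.QuantumAdvantage.Theorems.CubicForrelation.NearExactIsExact

open Finset
open Literature.Computability.QuantumComplexity
open Literature.Computability.QuantumComplexity.BuzetChailloux (bxor zeroVec bxor_bxor_cancel_left bxor_zeroVec zeroVec_bxor bxor_comm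
  bxor_self twist_zeroVec_right twist_bxor_right)
open Literature.Computability.QuantumComplexity.DerivativeWalsh (W card_mul_card_perp)
open Summit.QuantumAdvantage.QuantumAdvantage.Theorems.NearExactIsExact.Negative (TypeOTwelve.typeO_of_exists_odd)

/-- **No type-O(base `992`) × level-5 pair at `Φ ≥ 29/32`** (12 bits).  See the module docstring.  Finite-slice statement, NOT summit
progress. [this work] -/
theorem to22_typeO_E992_levelFive_partner_false (f g : (Fin (6 + 6) → Bool) → Bool) (hf : IsDegLeFun 3 f) (hg : IsDegLeFun 3 g)
    (u : (Fin (6 + 6) → Bool) → ℤ) (hu : ∀ x, W (fun y => signOf (g y)) x = (2 : ℝ) ^ 4 * (u x : ℝ))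
    (hodd : ∃ x, Odd (u x)) (hE : #(univ.filter fun x : Fin (6 + 6) → Bool => (Odd (u x / 2) ↔ Odd (u x / 2 / 2))) = 992)
    (uf' : (Fin (6 + 6) → Bool) → ℤ) (huf' : ∀ y, W (fun x => signOf (f x)) y = (2 : ℝ) ^ 5 * (uf' y : ℝ)) (hoddf : ∃ y, Odd (uf' y))
    (hΦ : (29 / 32 : ℝ) ≤ forrelation f g) : False := by
  classical
  have hΦ' : forrelation g f = forrelation f g := by
    rw [Summit.QuantumAdvantage.QuantumAdvantage.Theorems.SignedCubicForrelationNotPrBPP.Negative.HalfQuad.forrelation_comm]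
  have hlo' : (29 / 32 : ℝ) ≤ forrelation g f := by rw [hΦ']; exact hΦ
  obtain ⟨-, uf, huf, -, v, hv, -, k, hk8, -, hkval, hcard⟩ := to22_typeO_E992_ge2932_dichotomy f g hf hg u hu hodd hE hΦ
  -- `u_f = 2 u'_f`
  have huw : ∀ y, uf y = 2 * uf' y := by
    intro y
    have h := (huf y).symm.trans (huf' y)
    have h' : ((uf y : ℤ) : ℝ) = ((2 * uf' y : ℤ) : ℝ) := by
      push_cast
      have h2 : (2 : ℝ) ^ 4 ≠ 0 := by norm_num
      have : (2 : ℝ) ^ 4 * (uf y : ℝ) = (2 : ℝ) ^ 4 * (2 * (uf' y : ℝ)) := by rw [h]; ring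
      exact mul_left_cancel₀ h2 this
    exact_mod_cast h'
  -- the affine digit and the base set as a cubic support
  have hall : ∀ x, Odd (u x) := TypeOTwelve.typeO_of_exists_odd g u hg hu hodd
  have hu' : ∀ x, W (fun y => signOf (g y)) x = (2 : ℝ) ^ (2 * 2) * (u x : ℝ) := fun x => (hu x).trans (by norm_num)
  have hd1 : IsDegLeFun 1 (fun x => decide (Odd (u x / 2))) := z2_digitOne 2 g u hg hu' hall
  have hd2 : IsDegLeFun 3 (fun x => decide (Odd (u x / 2 / 2))) := z2_digitTwo 2 g u hg hu' hall
  obtain ⟨c₁, b₁, hcb⟩ := stub_affineForm (6 + 6) _ hd1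
  set E := univ.filter (fun x : Fin (6 + 6) → Bool => (Odd (u x / 2) ↔ Odd (u x / 2 / 2))) with hEdef
  have hdegE : IsDegLeFun (2 + 1) (fun x => (decide (Odd (u x / 2)) ^^ decide (Odd (u x / 2 / 2))) ^^ true) :=
    tb_isDegLeFun_xor_const (bb_isDegLeFun_bxor (hd1.mono (by norm_num)) hd2) true
  have hsetE : (univ.filter fun x : Fin (6 + 6) → Bool =>
      ((decide (Odd (u x / 2)) ^^ decide (Odd (u x / 2 / 2))) ^^ true) = true) = E := by
    rw [hEdef]
    apply filter_congr
    intro x _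
    by_cases h1 : Odd (u x / 2) <;> by_cases h2 : Odd (u x / 2 / 2) <;> simp [h1, h2]
  obtain ⟨mf, M, hEm, hM0, hMadd, hMcard, hMpar⟩ := to22_char_sum_E992_structure _ hdegE (by rw [hsetE]; exact hE)
  rw [hsetE] at hEm
  -- the partner identity: `2 u'_f = 4(−1)^g − 64 s_b [y = c₁] + 2 s_b m(c₁ ⊕ y) − k`
  have hsb : ((sZ b₁ : ℤ) : ℝ) = signOf b₁ := tp_sZ_cast _
  have hkm : ∀ y, k y = 4 * sZ (g y) - 64 * sZ b₁ * (if bxor c₁ y = (fun _ => false) then 1 else 0) +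
      2 * sZ b₁ * mf (bxor c₁ y) - 2 * uf' y := by
    intro y
    have h := to18_typeO_partner_identity f g u hu v hv c₁ b₁ hcb uf huf y
    rw [← hEdef, hEm, hk8, huw] at h
    have h' : ((k y : ℤ) : ℝ) = ((4 * sZ (g y) - 64 * sZ b₁ * (if bxor c₁ y = (fun _ => false) then 1 else 0) +
        2 * sZ b₁ * mf (bxor c₁ y) - 2 * uf' y : ℤ) : ℝ) := by
      have hsg := tp_sZ_cast (g y)
      rcases tp_sZ_cases b₁ with hs | hs
      all_goals
        rw [hs] at hsb ⊢
        push_cast at hsb h ⊢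
        rw [← hsb, ← hsg] at h
        split_ifs with hz
        · rw [if_pos hz] at h
          have e4096 : (2 : ℝ) ^ (6 + 6) = 4096 := by norm_num
          rw [e4096] at h
          linarith
        · rw [if_neg hz] at h
          linarith
    exact_mod_cast h'
  -- the odd set `P_f` of `u'_f` is `M' Δ K`
  set Pf := univ.filter (fun y : Fin (6 + 6) → Bool => Odd (uf' y)) with hPfdef
  set M' := M.image (bxor c₁) with hM'def
  set K := univ.filter (fun y : Fin (6 + 6) → Bool => k y ≠ 0) with hKdef
  have hmemM' : ∀ y, y ∈ M' ↔ bxor c₁ y ∈ M := by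
    intro y
    rw [hM'def, mem_image]
    constructor
    · rintro ⟨a, ha, rfl⟩; rw [bxor_bxor_cancel_left]; exact ha
    · intro hy; exact ⟨bxor c₁ y, hy, bxor_bxor_cancel_left c₁ y⟩
  have hM'card : #M' = 2048 := by
    rw [hM'def, card_image_of_injective _ (fun x y h => by
      have := congrArg (bxor c₁) h; rwa [bxor_bxor_cancel_left, bxor_bxor_cancel_left] at this), hMcard]
  have hKcard : #K = 256 := hcard
  have hmemP : ∀ y, y ∈ Pf ↔ (y ∈ M' ↔ y ∉ K) := by
    intro y
    rw [hPfdef, mem_filter, hmemM', ← hMpar, hKdef, mem_filter, Int.odd_iff, Int.odd_iff]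
    have h := hkm y
    have hsg := tp_sZ_cases (g y)
    simp only [mem_univ, true_and, not_not]
    rcases tp_sZ_cases b₁ with hs | hs <;> rw [hs] at h <;> rcases hkval y with hk | hk | hk <;> rw [hk] at h ⊢ <;>
      split_ifs at h <;> omega
  -- counting: `#P_f + 2·#(M' ∩ K) = 2304`, `#P_f = 2048`
  have hPcard : #Pf = 2048 := tw22_oddset_card_ge2932 g f hf uf' huf' hoddf hlo'
  have hcount : (#Pf : ℤ) + 2 * #(M' ∩ K) = 2304 := by
    have hZ : (#Pf : ℤ) = ∑ y, (if (y ∈ M' ↔ y ∉ K) then 1 else 0 : ℤ) := by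
      rw [sum_boole]
      have e : (univ.filter fun y => (y ∈ M' ↔ y ∉ K)) = Pf := by
        ext y; rw [mem_filter, hmemP y]; simp only [mem_univ, true_and]
      rw [e]
    have hM'sum : (#M' : ℤ) = ∑ y, (if y ∈ M' then 1 else 0 : ℤ) := by
      rw [sum_boole]
      have e : (univ.filter fun y => y ∈ M') = M' := by ext y; rw [mem_filter]; simp only [mem_univ, true_and]
      rw [e]
    have hKsum : (#K : ℤ) = ∑ y, (if y ∈ K then 1 else 0 : ℤ) := by
      rw [sum_boole]
      have e : (univ.filter fun y => y ∈ K) = K := by ext y; rw [mem_filter]; simp only [mem_univ, true_and]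
      rw [e]
    have hIsum : (#(M' ∩ K) : ℤ) = ∑ y, (if (y ∈ M' ∧ y ∈ K) then 1 else 0 : ℤ) := by
      rw [sum_boole]
      have e : (univ.filter fun y => y ∈ M' ∧ y ∈ K) = M' ∩ K := by
        ext y; rw [mem_filter, mem_inter]; simp only [mem_univ, true_and]
      rw [e]
    have hpt : ∀ y, (if (y ∈ M' ↔ y ∉ K) then 1 else 0 : ℤ) + 2 * (if (y ∈ M' ∧ y ∈ K) then 1 else 0 : ℤ) =
        (if y ∈ M' then 1 else 0 : ℤ) + (if y ∈ K then 1 else 0 : ℤ) := by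
      intro y
      by_cases h1 : y ∈ M' <;> by_cases h2 : y ∈ K <;> simp [h1, h2]
    have h := sum_congr rfl fun y (_ : y ∈ (univ : Finset (Fin (6 + 6) → Bool))) => hpt y
    rw [sum_add_distrib, sum_add_distrib, ← mul_sum, ← hZ, ← hIsum, ← hM'sum, ← hKsum, hM'card, hKcard] at h
    push_cast at h
    linarith
  have hIcard : #(M' ∩ K) = 128 := by
    have : (#(M' ∩ K) : ℤ) = 128 := by rw [hPcard] at hcount; push_cast at hcount; linarith
    exact_mod_cast this
  -- `P_f ∩ M'` has `1920` points …
  have hPM : #(Pf ∩ M') = 1920 := by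
    have hsub : Pf ∩ M' = M'.filter (fun y => y ∉ K) := by
      ext y
      simp only [mem_inter, mem_filter]
      rw [hmemP y]
      constructor
      · rintro ⟨h1, h2⟩; exact ⟨h2, h1.1 h2⟩
      · rintro ⟨h1, h2⟩; exact ⟨⟨fun _ => h2, fun _ => h1⟩, h1⟩
    rw [hsub]
    have h := Finset.card_filter_add_card_filter_not (s := M') (fun y => y ∉ K)
    have e2 : M'.filter (fun y => ¬ y ∉ K) = M' ∩ K := by
      ext y; simp only [mem_filter, mem_inter, not_not]
    rw [e2, hIcard, hM'card] at h
    omega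
  -- … but `P_f` is an affine hyperplane `x₀ ⊕ V_f`, and `P_f ∩ M'` a translate of the subspace `V_f ∩ M`
  obtain ⟨γ, tg, htg, hγ0, hPg⟩ := tw22_hyperplane_ge2932 g f hf uf' huf' hoddf hlo'
  set Vf := univ.filter (fun a : Fin (6 + 6) → Bool => twist γ a = 1) with hVfdef
  have hVmem : ∀ a, a ∈ Vf ↔ twist γ a = 1 := fun a => by rw [hVfdef, mem_filter]; simp
  have hVadd : ∀ x ∈ Vf, ∀ y ∈ Vf, bxor x y ∈ Vf := by
    intro x hx y hy; rw [hVmem] at hx hy ⊢; rw [twist_bxor_right, hx, hy, mul_one]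
  have hV0 : zeroVec ∈ Vf := (hVmem _).2 (twist_zeroVec_right γ)
  have hmemP' : ∀ y, y ∈ Pf ↔ twist γ y = tg := fun y => by rw [hPfdef, mem_filter]; simp [hPg y]
  obtain ⟨p, hp⟩ : (Pf ∩ M').Nonempty := card_pos.1 (by rw [hPM]; norm_num)
  have hpP : p ∈ Pf := (mem_inter.1 hp).1
  have hpM : p ∈ M' := (mem_inter.1 hp).2
  have hS : Pf = Vf.image (bxor p) := tw59_eq_image Pf Vf γ tg hmemP' hVmem p hpP
  have hxor3 : ∀ a x y : Fin (6 + 6) → Bool, bxor (bxor a x) (bxor a y) = bxor x y := by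
    intro a x y; funext i; simp only [bxor]; cases a i <;> cases x i <;> cases y i <;> rfl
  have hxor4 : ∀ a x y : Fin (6 + 6) → Bool, bxor a (bxor x y) = bxor (bxor a x) y := by
    intro a x y; funext i; simp only [bxor]; cases a i <;> cases x i <;> cases y i <;> rfl
  have himg : Pf ∩ M' = (Vf ∩ M).image (bxor p) := by
    ext y
    simp only [mem_inter, Finset.mem_image]
    constructor
    · rintro ⟨hyP, hyM⟩
      refine ⟨bxor p y, ⟨?_, ?_⟩, bxor_bxor_cancel_left p y⟩
      · have h1 := fl1_coset_diff hS hpP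
        have h2 := fl1_coset_diff hS hyP
        have := hVadd _ h1 _ h2
        rwa [hxor3] at this
      · have h1 := (hmemM' p).1 hpM
        have h2 := (hmemM' y).1 hyM
        have := hMadd _ h1 _ h2
        rwa [hxor3] at this
    · rintro ⟨a, ⟨haV, haM⟩, rfl⟩
      refine ⟨fl1_coset_vadd hVadd hS hpP haV, ?_⟩
      rw [hmemM']
      have h1 := (hmemM' p).1 hpM
      have := hMadd _ h1 _ haM
      rwa [← hxor4] at this
  have hVMcard : #(Vf ∩ M) = 1920 := by
    rw [← hPM, himg, card_image_of_injective _ (fun x y h => by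
      have := congrArg (bxor p) h; rwa [bxor_bxor_cancel_left, bxor_bxor_cancel_left] at this)]
  have hVM0 : zeroVec ∈ Vf ∩ M := mem_inter.2 ⟨hV0, hM0⟩
  have hVMadd : ∀ x ∈ Vf ∩ M, ∀ y ∈ Vf ∩ M, bxor x y ∈ Vf ∩ M := fun x hx y hy =>
    mem_inter.2 ⟨hVadd _ (mem_inter.1 hx).1 _ (mem_inter.1 hy).1, hMadd _ (mem_inter.1 hx).2 _ (mem_inter.1 hy).2⟩
  have hperp := card_mul_card_perp hVM0 hVMadd
  rw [hVMcard] at hperp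
  have hnat : 1920 * #(univ.filter fun y : Fin (6 + 6) → Bool => ∀ x ∈ Vf ∩ M, twist x y = 1) = 4096 := by
    have h' : ((1920 * #(univ.filter fun y : Fin (6 + 6) → Bool => ∀ x ∈ Vf ∩ M, twist x y = 1) : ℕ) : ℝ) = ((4096 : ℕ) : ℝ) := by
      push_cast at hperp ⊢; rw [hperp]; norm_num
    exact_mod_cast h'
  omega

/-- **No type-O side with base set `992` at `Φ ≥ 29/32`** (12 bits): the partner would be type O, level 5 or level `≥ 6`, all three dead
(`to22_typeO_E992_typeO_partner_false`, `to22_typeO_E992_levelFive_partner_false`, `to22_typeO_E992_levelSix_partner_false`).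
Finite-slice statement, NOT summit progress. [this work] -/
theorem to22_typeO_E992_ge2932_false (f g : (Fin (6 + 6) → Bool) → Bool) (hf : IsDegLeFun 3 f) (hg : IsDegLeFun 3 g)
    (u : (Fin (6 + 6) → Bool) → ℤ) (hu : ∀ x, W (fun y => signOf (g y)) x = (2 : ℝ) ^ 4 * (u x : ℝ))
    (hodd : ∃ x, Odd (u x)) (hE : #(univ.filter fun x : Fin (6 + 6) → Bool => (Odd (u x / 2) ↔ Odd (u x / 2 / 2))) = 992)
    (hΦ : (29 / 32 : ℝ) ≤ forrelation f g) : False := by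
  obtain ⟨uf, huf⟩ := tw_base (n := 6 + 6) f hf 4 (by norm_num)
  by_cases hO : ∃ y, Odd (uf y)
  · exact to22_typeO_E992_typeO_partner_false f g hf hg u hu hodd hE uf huf hO hΦ
  push Not at hO
  have huf5 := tw_level_up (j := 4) f uf huf hO
  by_cases hO5 : ∃ y, Odd (uf y / 2)
  · exact to22_typeO_E992_levelFive_partner_false f g hf hg u hu hodd hE (fun y => uf y / 2) huf5 hO5 hΦ
  push Not at hO5
  have huf6 := tw_level_up (j := 5) f (fun y => uf y / 2) huf5 hO5
  exact to22_typeO_E992_levelSix_partner_false f g hf hg u hu hodd hE (fun y => uf y / 2 / 2) huf6 hΦ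

end Summit.QuantumAdvantage.QuantumAdvantage.Theorems.CubicForrelation.NearExactIsExact

end
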